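import Literature.Probability.RandomPlanarGeometry.SelfAvoidingWalk
import HarnessLib

/-!
# Restriction covariance of the critical planar SAW law

Topic `Literature/Probability/RandomPlanarGeometry` (companion to `SelfAvoidingWalk.lean`).
The critical two-point SAW measure `P_δ(γ) ∝ x_c^{|γ|}` on the self-avoiding walks of a discrete
domain `Ω_δ ⊆ δℤ²` from `u` to `v` (`SAW.law Ω δ u v`) is CONFIGURATIONAL, so for nested discrete
domains it satisfies the exact restriction property of Lawler–Schramm–Werner (the discrete
counterpart of the restriction covariance of `SLE_{8/3}`): conditioning the walk of the big
domain `Ω_δ` to be a walk of the small domain `Ω'_δ` gives the walk of `Ω'_δ`.  We record it in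
the inequality form consumed by transfer ("socket comparison") arguments, for every set `E` of
curves:

  `law Ω' {polyline ∈ E} · law Ω {γ is (the support of) an Ω'_δ-walk} ≤ law Ω {polyline ∈ E}`
  (`law_mul_law_setOf_exists_support_eq_le`),

valid whenever every `Ω'_δ`-walk `u → v` is, with the same support, an `Ω_δ`-walk ("nesting";
all junk cases — zero or infinite total weight — included, the left side being `0` there).
Proof: with `Z = weight Ω univ`, `Z' = weight Ω' univ`, the confinement event of `Ω_δ` weighs at
most `Z'` (each confined `Ω`-walk comes from a unique `Ω'`-walk of the same weight,
`weight_setOf_exists_support_eq_le`) and `W'(E) ≤ W(E)` under nesting (each `Ω'`-walk is an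
`Ω`-walk of the same weight and the same polyline, `weight_setOf_toCurve_mem_le`), so
`Z'⁻¹ W'(E) · Z⁻¹ W(Conf) ≤ (Z'⁻¹ Z') · Z⁻¹ W'(E) ≤ Z⁻¹ W(E)`.

Also: the weight of a set as a sum (`weight_apply_eq_tsum_indicator`), the law as normalised
weight (`law_apply_eq_inv_mul_weight`), and that a SAW of `Ω_δ` is determined by its support,
which also determines its length and its polyline (`DomainSAW.ext_support`,
`DomainSAW.length_eq_of_support_eq`, `DomainSAW.toCurve_eq_of_support_eq`).

References: G. F. Lawler, O. Schramm, W. Werner, *On the scaling limit of planar self-avoiding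
walk* (2004), §3 (the restriction property of the SAW measures); folklore for the lattice
identity itself.  Mathlib anchors: `SimpleGraph.Walk.support_injective`,
`ENNReal.tsum_comp_le_tsum_of_injective`, `ENNReal.inv_mul_le_one`, `Measure.sum_apply`.
-/

noncomputable section

open _root_.MeasureTheory _root_.Set
open scoped ENNReal
open Literature.Probability.LatticeModels

namespace Literature.Probability.RandomPlanarGeometry.SAW

variable {Ω' Ω : Set ℂ} {δ : ℝ} {u v : Site 2}

/-- The weight of a set of SAWs is the sum of the weights `x_c^{|γ|}` of its members. [folklore] -/
theorem weight_apply_eq_tsum_indicator (Ω : Set ℂ) (δ : ℝ) (u v : Site 2)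
    (S : Set (DomainSAW Ω δ u v)) :
    weight Ω δ u v S =
      ∑' γ, S.indicator (fun γ => ENNReal.ofReal (criticalFugacity ^ γ.length)) γ := by
  rw [weight, Measure.sum_apply _ MeasurableSpace.measurableSet_top]
  refine tsum_congr fun γ => ?_
  rw [Measure.smul_apply, Measure.dirac_apply' _ MeasurableSpace.measurableSet_top, smul_eq_mul]
  by_cases h : γ ∈ S <;> simp [h]

/-- The law is the normalised weight: `law S = (weight univ)⁻¹ · weight S`. [folklore] -/
theorem law_apply_eq_inv_mul_weight (Ω : Set ℂ) (δ : ℝ) (u v : Site 2)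
    (S : Set (DomainSAW Ω δ u v)) :
    law Ω δ u v S = (weight Ω δ u v Set.univ)⁻¹ * weight Ω δ u v S := by
  rw [law, Measure.smul_apply, smul_eq_mul]

/-- A SAW of `Ω_δ` is determined by its support (the list of its vertices). [folklore] -/
theorem DomainSAW.ext_support {γ₁ γ₂ : DomainSAW Ω δ u v}
    (h : γ₁.walk.support = γ₂.walk.support) : γ₁ = γ₂ := by
  obtain ⟨p, hp⟩ := γ₁
  obtain ⟨q, hq⟩ := γ₂
  have hpq : p = q := SimpleGraph.Walk.support_injective h
  subst hpq
  rfl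

/-- Walks with the same support (possibly in different discrete domains) have the same length.
[folklore] -/
theorem DomainSAW.length_eq_of_support_eq {γ' : DomainSAW Ω' δ u v} {γ : DomainSAW Ω δ u v}
    (h : γ.walk.support = γ'.walk.support) : γ.length = γ'.length := by
  have h1 := congrArg List.length h
  rw [SimpleGraph.Walk.length_support, SimpleGraph.Walk.length_support] at h1
  show γ.walk.length = γ'.walk.length
  omega

/-- Walks with the same support trace the same polyline (`SimpleGraph.Walk.toCurve` depends on
the support only). [folklore] -/
theorem DomainSAW.toCurve_eq_of_support_eq {γ' : DomainSAW Ω' δ u v} {γ : DomainSAW Ω δ u v}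
    (h : γ.walk.support = γ'.walk.support) :
    (⟨γ.walk.toCurve (meshPoint δ)⟩ : Curve ℂ) = ⟨γ'.walk.toCurve (meshPoint δ)⟩ := by
  simp only [SimpleGraph.Walk.toCurve, h]

/-- **Half of the identity, no nesting needed**: the weight, in `Ω_δ`, of the confinement event
"`γ` is (the support of) a walk of `Ω'_δ`" is at most the total weight of `Ω'_δ` (each confined
`Ω`-walk comes from a unique `Ω'`-walk with the same weight). [folklore] -/
theorem weight_setOf_exists_support_eq_le (Ω' Ω : Set ℂ) (δ : ℝ) (u v : Site 2) :
    weight Ω δ u v {γ | ∃ γ' : DomainSAW Ω' δ u v, γ'.walk.support = γ.walk.support} ≤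
      weight Ω' δ u v Set.univ := by
  classical
  set C : Set (DomainSAW Ω δ u v) :=
    {γ | ∃ γ' : DomainSAW Ω' δ u v, γ'.walk.support = γ.walk.support} with hC
  rw [weight_apply_eq_tsum_indicator, weight_apply_eq_tsum_indicator, ← tsum_subtype]
  -- the `Ω'`-walk behind a confined `Ω`-walk
  have hex : ∀ γ : C, ∃ γ' : DomainSAW Ω' δ u v, γ'.walk.support = γ.1.walk.support :=
    fun γ => γ.2
  choose κ hκ using hex
  have hinj : Function.Injective κ := by
    intro γ₁ γ₂ h
    apply Subtype.ext
    apply DomainSAW.ext_support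
    rw [← hκ γ₁, ← hκ γ₂, h]
  calc ∑' γ : C, ENNReal.ofReal (criticalFugacity ^ γ.1.length)
      = ∑' γ : C, Set.univ.indicator (fun γ' : DomainSAW Ω' δ u v =>
            ENNReal.ofReal (criticalFugacity ^ γ'.length)) (κ γ) := by
        refine tsum_congr fun γ => ?_
        rw [Set.indicator_of_mem (Set.mem_univ _), DomainSAW.length_eq_of_support_eq (hκ γ).symm]
    _ ≤ ∑' γ', Set.univ.indicator (fun γ' : DomainSAW Ω' δ u v =>
          ENNReal.ofReal (criticalFugacity ^ γ'.length)) γ' :=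
        ENNReal.tsum_comp_le_tsum_of_injective hinj _

/-- **The other half, under nesting**: if every `Ω'_δ`-walk `u → v` is, with the same support, an
`Ω_δ`-walk, then for every set `E` of curves the weight of `{polyline ∈ E}` among `Ω'`-walks is at
most its weight among `Ω`-walks (each `Ω'`-walk IS an `Ω`-walk with the same weight and the same
polyline). [folklore] -/
theorem weight_setOf_toCurve_mem_le
    (hN : ∀ γ' : DomainSAW Ω' δ u v, ∃ γ : DomainSAW Ω δ u v, γ.walk.support = γ'.walk.support)
    (E : Set (Curve ℂ)) :
    weight Ω' δ u v {γ' | (⟨γ'.walk.toCurve (meshPoint δ)⟩ : Curve ℂ) ∈ E} ≤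
      weight Ω δ u v {γ | (⟨γ.walk.toCurve (meshPoint δ)⟩ : Curve ℂ) ∈ E} := by
  classical
  rw [weight_apply_eq_tsum_indicator, weight_apply_eq_tsum_indicator]
  choose ι hι using hN
  have hinj : Function.Injective ι := by
    intro γ₁ γ₂ h
    apply DomainSAW.ext_support
    rw [← hι γ₁, ← hι γ₂, h]
  set E' : Set (DomainSAW Ω' δ u v) := {γ' | (⟨γ'.walk.toCurve (meshPoint δ)⟩ : Curve ℂ) ∈ E}
    with hE'
  set EΩ : Set (DomainSAW Ω δ u v) := {γ | (⟨γ.walk.toCurve (meshPoint δ)⟩ : Curve ℂ) ∈ E}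
    with hEΩ
  calc ∑' γ', E'.indicator (fun γ' => ENNReal.ofReal (criticalFugacity ^ γ'.length)) γ'
      = ∑' γ', EΩ.indicator (fun γ => ENNReal.ofReal (criticalFugacity ^ γ.length)) (ι γ') := by
        refine tsum_congr fun γ' => ?_
        have hc := DomainSAW.toCurve_eq_of_support_eq (hι γ')
        have hl := DomainSAW.length_eq_of_support_eq (hι γ')
        by_cases h : (⟨γ'.walk.toCurve (meshPoint δ)⟩ : Curve ℂ) ∈ E
        · have h' : ι γ' ∈ EΩ := by
            show (⟨(ι γ').walk.toCurve (meshPoint δ)⟩ : Curve ℂ) ∈ E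
            rwa [hc]
          rw [Set.indicator_of_mem (show γ' ∈ E' from h), Set.indicator_of_mem h', hl]
        · have h' : ι γ' ∉ EΩ := by
            show ¬ ((⟨(ι γ').walk.toCurve (meshPoint δ)⟩ : Curve ℂ) ∈ E)
            rwa [hc]
          rw [Set.indicator_of_notMem (show γ' ∉ E' from h), Set.indicator_of_notMem h']
    _ ≤ ∑' γ, EΩ.indicator (fun γ => ENNReal.ofReal (criticalFugacity ^ γ.length)) γ :=
        ENNReal.tsum_comp_le_tsum_of_injective hinj _

/-- **Restriction covariance of the critical SAW law** (Lawler–Schramm–Werner's restriction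
property, lattice form, as an inequality covering the junk cases): if every `Ω'_δ`-walk `u → v`
is, with the same support, an `Ω_δ`-walk, then for every set `E` of curves
`law Ω' {polyline ∈ E} · law Ω {γ is an Ω'_δ-walk} ≤ law Ω {polyline ∈ E}`.
With `Z = weight Ω univ`, `Z' = weight Ω' univ`: the left side is
`Z'⁻¹ W'(E) · Z⁻¹ W(Conf) ≤ Z'⁻¹ W'(E) · Z⁻¹ Z' = (Z'⁻¹ Z') · Z⁻¹ W'(E) ≤ Z⁻¹ W'(E) ≤ Z⁻¹ W(E)`.
[cite: LawlerSchrammWerner2004SAW, §3] -/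
theorem law_mul_law_setOf_exists_support_eq_le
    (hN : ∀ γ' : DomainSAW Ω' δ u v, ∃ γ : DomainSAW Ω δ u v, γ.walk.support = γ'.walk.support)
    (E : Set (Curve ℂ)) :
    law Ω' δ u v {γ' | (⟨γ'.walk.toCurve (meshPoint δ)⟩ : Curve ℂ) ∈ E} *
        law Ω δ u v {γ | ∃ γ' : DomainSAW Ω' δ u v, γ'.walk.support = γ.walk.support} ≤
      law Ω δ u v {γ | (⟨γ.walk.toCurve (meshPoint δ)⟩ : Curve ℂ) ∈ E} := by
  rw [law_apply_eq_inv_mul_weight, law_apply_eq_inv_mul_weight, law_apply_eq_inv_mul_weight]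
  set Z := weight Ω δ u v Set.univ
  set Z' := weight Ω' δ u v Set.univ
  set WE' := weight Ω' δ u v {γ' | (⟨γ'.walk.toCurve (meshPoint δ)⟩ : Curve ℂ) ∈ E}
  set WE := weight Ω δ u v {γ | (⟨γ.walk.toCurve (meshPoint δ)⟩ : Curve ℂ) ∈ E}
  set WC := weight Ω δ u v {γ | ∃ γ' : DomainSAW Ω' δ u v, γ'.walk.support = γ.walk.support}
  have h1 : WC ≤ Z' := weight_setOf_exists_support_eq_le Ω' Ω δ u v
  have h2 : WE' ≤ WE := weight_setOf_toCurve_mem_le hN E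
  calc Z'⁻¹ * WE' * (Z⁻¹ * WC) ≤ Z'⁻¹ * WE' * (Z⁻¹ * Z') := by gcongr
    _ = (Z'⁻¹ * Z') * (Z⁻¹ * WE') := by ring
    _ ≤ 1 * (Z⁻¹ * WE') := by gcongr; exact ENNReal.inv_mul_le_one Z'
    _ = Z⁻¹ * WE' := one_mul _
    _ ≤ Z⁻¹ * WE := by gcongr

/-! ### The exact identity: confinement probability = ratio of partition functions -/

/-- **The other inequality for the confinement event, under nesting**: if every `Ω'_δ`-walk
`u → v` is, with the same support, an `Ω_δ`-walk, then the total weight `Z' = weight Ω' univ` of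
`Ω'_δ` is at most the weight, in `Ω_δ`, of the confinement event "`γ` is (the support of) a
walk of `Ω'_δ`" (each `Ω'`-walk IS a confined `Ω`-walk of the same weight, injectively).
[folklore] -/
theorem weight_univ_le_weight_setOf_exists_support_eq
    (hN : ∀ γ' : DomainSAW Ω' δ u v, ∃ γ : DomainSAW Ω δ u v, γ.walk.support = γ'.walk.support) :
    weight Ω' δ u v Set.univ ≤
      weight Ω δ u v {γ | ∃ γ' : DomainSAW Ω' δ u v, γ'.walk.support = γ.walk.support} := by
  classical
  rw [weight_apply_eq_tsum_indicator, weight_apply_eq_tsum_indicator]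
  choose ι hι using hN
  have hinj : Function.Injective ι := by
    intro γ₁ γ₂ h
    apply DomainSAW.ext_support
    rw [← hι γ₁, ← hι γ₂, h]
  set C : Set (DomainSAW Ω δ u v) :=
    {γ | ∃ γ' : DomainSAW Ω' δ u v, γ'.walk.support = γ.walk.support} with hC
  calc ∑' γ', Set.univ.indicator (fun γ' : DomainSAW Ω' δ u v =>
          ENNReal.ofReal (criticalFugacity ^ γ'.length)) γ'
      = ∑' γ', C.indicator (fun γ => ENNReal.ofReal (criticalFugacity ^ γ.length)) (ι γ') := by
        refine tsum_congr fun γ' => ?_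
        have hmem : ι γ' ∈ C := ⟨γ', (hι γ').symm⟩
        rw [Set.indicator_of_mem (Set.mem_univ _), Set.indicator_of_mem hmem,
          DomainSAW.length_eq_of_support_eq (hι γ')]
    _ ≤ ∑' γ, C.indicator (fun γ => ENNReal.ofReal (criticalFugacity ^ γ.length)) γ :=
        ENNReal.tsum_comp_le_tsum_of_injective hinj _

/-- **Exact restriction identity, weight form**: under nesting, the weight in `Ω_δ` of the
confinement event "`γ` is (the support of) a walk of `Ω'_δ`" EQUALS the partition function
`Z' = weight Ω' univ` of the small discrete domain (the map `γ' ↦ its Ω-copy` is a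
weight-preserving bijection onto the event; `weight_setOf_exists_support_eq_le` and
`weight_univ_le_weight_setOf_exists_support_eq`). [cite: LawlerSchrammWerner2004SAW, §3] -/
theorem weight_setOf_exists_support_eq_eq
    (hN : ∀ γ' : DomainSAW Ω' δ u v, ∃ γ : DomainSAW Ω δ u v, γ.walk.support = γ'.walk.support) :
    weight Ω δ u v {γ | ∃ γ' : DomainSAW Ω' δ u v, γ'.walk.support = γ.walk.support} =
      weight Ω' δ u v Set.univ :=
  le_antisymm (weight_setOf_exists_support_eq_le Ω' Ω δ u v)
    (weight_univ_le_weight_setOf_exists_support_eq hN)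

/-- **Monotonicity of the critical partition function under nesting**: `Z' ≤ Z`, i.e.
`weight Ω' univ ≤ weight Ω univ`, when every `Ω'_δ`-walk `u → v` is, with the same support, an
`Ω_δ`-walk. [folklore] -/
theorem weight_univ_le_weight_univ
    (hN : ∀ γ' : DomainSAW Ω' δ u v, ∃ γ : DomainSAW Ω δ u v, γ.walk.support = γ'.walk.support) :
    weight Ω' δ u v Set.univ ≤ weight Ω δ u v Set.univ :=
  (weight_univ_le_weight_setOf_exists_support_eq hN).trans (measure_mono (Set.subset_univ _))

/-- **Confinement probability = ratio of partition functions** (the exact restriction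
identity of the critical SAW law, lattice form; companion to the inequality
`law_mul_law_setOf_exists_support_eq_le`): under nesting, the law in `Ω_δ` of the confinement
event "`γ` is (the support of) a walk of `Ω'_δ`" is `Z⁻¹ · Z'` with `Z = weight Ω univ`,
`Z' = weight Ω' univ` (all junk cases included: both sides are `0` if `Z = 0`, as then
`Z' ≤ Z = 0`, or if `Z = ∞`). [cite: LawlerSchrammWerner2004SAW, §3] -/
theorem law_setOf_exists_support_eq_eq
    (hN : ∀ γ' : DomainSAW Ω' δ u v, ∃ γ : DomainSAW Ω δ u v, γ.walk.support = γ'.walk.support) :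
    law Ω δ u v {γ | ∃ γ' : DomainSAW Ω' δ u v, γ'.walk.support = γ.walk.support} =
      (weight Ω δ u v Set.univ)⁻¹ * weight Ω' δ u v Set.univ := by
  rw [law_apply_eq_inv_mul_weight, weight_setOf_exists_support_eq_eq hN]

/-- **Lower bounds on the confinement probability are lower bounds on the ratio of partition
functions**: under nesting and for a genuine partition function `0 < Z < ∞` of the big
discrete domain, `p ≤ law Ω {γ is an Ω'_δ-walk} ↔ p · Z ≤ Z'`.  (So a confinement bound
`P_Ω[γ ⊆ Ω'_δ] ≥ c` uniform in the mesh is exactly a lower bound `Z' ≥ c Z` on a constrained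
critical partition function.) [folklore] -/
theorem le_law_setOf_exists_support_eq_iff
    (hN : ∀ γ' : DomainSAW Ω' δ u v, ∃ γ : DomainSAW Ω δ u v, γ.walk.support = γ'.walk.support)
    (h0 : weight Ω δ u v Set.univ ≠ 0) (htop : weight Ω δ u v Set.univ ≠ ∞) (p : ℝ≥0∞) :
    p ≤ law Ω δ u v {γ | ∃ γ' : DomainSAW Ω' δ u v, γ'.walk.support = γ.walk.support} ↔
      p * weight Ω δ u v Set.univ ≤ weight Ω' δ u v Set.univ := by
  rw [law_setOf_exists_support_eq_eq hN, mul_comm, ← div_eq_mul_inv,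
    ENNReal.le_div_iff_mul_le (Or.inl h0) (Or.inl htop)]

end Literature.Probability.RandomPlanarGeometry.SAW

end
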